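import Summits.ValiantsHypothesis.ValiantsHypothesis.Theorems.BarrierLeverAnchoredDoorHitsLowerPairsDecrementGeneralOwner
import Summits.ValiantsHypothesis.ValiantsHypothesis.Theorems.BarrierLeverAnchoredDoorHitsLowerPairsDecrementGeneralBlocks

/-!
# Support item `AnchoredDoorHitsLowerPairs` (stmt-ValiantsHypothesis-22510), line `anchored-peeling`:
# THE DECREMENT CERTIFICATE FOR GENERAL `k` — THE DIAGONAL, AND TRIANGULARITY AT THE CLASS-0 COLUMNS (∅, vertices, ω-edges)

Helper file (`--supports stmt-ValiantsHypothesis-22510`; cell valiant-natproofs, rung V4, 𝒟-side door (c); registered line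
`Cruxes/AnchoredDoorHitsLowerPairs/Lines/anchored_peeling.lean` v20, registered stub `Stmt.stub_decrementFamily` (CONJECTURE DC, `…DecrementFamily`,
p650456); prover seat val-np-p1 gen 23; memo HOME/val-np-p1/g22/MEMO-relapex-valnp1-g22.md §12–§15 = the paper proof being formalised; definitions in
`…DecrementGeneralDefs` (p652973)). Closes NO item by itself; part of the kernel proof of `theorem stub_decrementFamily` (`…DecrementGeneral`).

WHAT. (§7–§9 of the development.) Block constructors (`isBlock_gam_persona`, `isBlock_gam_alpha`, `isBlock_om_alpha`, `isBlock_del_persona`,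
`isBlock_del_alpha`); `doorSupp_dRow`: **every valid column supports its designated row** (explicit blocks). `supp_empty`, `supp_om`, `supp_gam`,
`supp_del`, `supp_omGam`, `supp_omDel`: **a row in the support of such a column is the designated row, or its owner has a strictly smaller key** (memo §15,
class 0; no popcount needed: a proper sub-index-set has smaller binary value).

WHAT THIS IS NOT: nothing on crux stmt-ValiantsHypothesis-14610 or on `VP` versus `VNP`.
-/

set_option linter.dupNamespace false

namespace Summit.ValiantsHypothesis.ValiantsHypothesis.Theorems.BarrierLever.AnchoredPeeling

namespace DecFamily

open Finset

variable {h : ℕ}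

/-! ## 7 (continued). Block constructors (for the diagonal) -/

section Blocks

variable {k : ℕ}

/-! ### Block constructors (for the diagonal) -/

/-- The persona block of `γ_P` on `S`, `ρ(P) ∈ S ⊆ P`. -/
theorem isBlock_gam_persona {v : Fin h} {c : ℕ} {S : Finset ℕ} (hv : v.val + 1 = c) (hc : c < 2 ^ k) (hkh : 2 * k + 1 ≤ h)
    (hS : S ⊆ bits c) (hρ : rho c ∈ S) : IsBlock (roots k) (tails k) v (rowOf k S false ∅) := by
  subst hv
  have hρk : rho (v.val + 1) < k := rho_lt (by omega) hc
  have hSr : S ⊆ range k := hS.trans (bits_subset_range hc)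
  refine ⟨⟨rho (v.val + 1), by omega⟩, mem_roots.mpr (Or.inr (Or.inl ⟨hc, rfl⟩)), mem_rowOf.mpr (Or.inl ⟨hρk, hρ⟩), fun x hx => ?_⟩
  rw [Finset.mem_insert]
  rcases mem_rowOf.mp hx with ⟨h1, h2⟩ | ⟨_, h3⟩ | ⟨_, h4⟩
  · by_cases hxρ : x.val = rho (v.val + 1)
    · exact Or.inl (Fin.ext hxρ)
    · exact Or.inr (mem_tails.mpr (Or.inl ⟨hc, Or.inl ⟨rfl, h1, hS h2, hxρ⟩⟩))
  · exact absurd h3 Bool.false_ne_true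
  · exact absurd h4 (Finset.notMem_empty _)

/-- The `α`-block of `γ_P` on `Y ⊆ P`. -/
theorem isBlock_gam_alpha {v : Fin h} {c : ℕ} {Y : Finset ℕ} (hv : v.val + 1 = c) (hc : c < 2 ^ k) (hkh : 2 * k + 1 ≤ h) (hY : Y ⊆ bits c) :
    IsBlock (roots k) (tails k) v (rowOf k ∅ true Y) := by
  subst hv
  refine ⟨⟨k, by omega⟩, mem_roots.mpr (Or.inl rfl), mem_rowOf.mpr (Or.inr (Or.inl ⟨rfl, rfl⟩)), fun x hx => ?_⟩
  rw [Finset.mem_insert]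
  rcases mem_rowOf.mp hx with ⟨_, h2⟩ | ⟨h3, _⟩ | ⟨h4, h5⟩
  · exact absurd h2 (Finset.notMem_empty _)
  · exact Or.inl (Fin.ext h3)
  · exact Or.inr (mem_tails.mpr (Or.inl ⟨hc, Or.inr ⟨rfl, h4, hY h5⟩⟩))

/-- The block of `ω`. -/
theorem isBlock_om_alpha {v : Fin h} (hc : v.val + 1 = 2 ^ k) (hkh : 2 * k + 1 ≤ h) : IsBlock (roots k) (tails k) v (rowOf k ∅ true ∅) := by
  refine ⟨⟨k, by omega⟩, mem_roots.mpr (Or.inl rfl), mem_rowOf.mpr (Or.inr (Or.inl ⟨rfl, rfl⟩)), fun x hx => ?_⟩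
  rw [Finset.mem_insert]
  rcases mem_rowOf.mp hx with ⟨_, h2⟩ | ⟨h3, _⟩ | ⟨_, h5⟩
  · exact absurd h2 (Finset.notMem_empty _)
  · exact Or.inl (Fin.ext h3)
  · exact absurd h5 (Finset.notMem_empty _)

/-- The persona block of `δ_Q` on `T`, `ρ(Q) ∈ T ⊆ Q`. -/
theorem isBlock_del_persona {v : Fin h} {Q : ℕ} {T : Finset ℕ} (hv : v.val + 1 = 2 ^ k + Q) (hQ1 : 1 ≤ Q) (hQ : Q < 2 ^ k) (hkh : 2 * k + 1 ≤ h)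
    (hT : T ⊆ bits Q) (hρ : rho Q ∈ T) : IsBlock (roots k) (tails k) v (rowOf k ∅ false T) := by
  have hc : 2 ^ k < v.val + 1 := by omega
  have hQv : v.val + 1 - 2 ^ k = Q := by omega
  rw [← hQv] at hT hρ hQ
  have hρk : rho (v.val + 1 - 2 ^ k) < k := rho_lt (by omega) hQ
  refine ⟨⟨k + 1 + rho (v.val + 1 - 2 ^ k), by omega⟩, mem_roots.mpr (Or.inr (Or.inr ⟨hc, rfl⟩)),
    mem_rowOf.mpr (Or.inr (Or.inr ⟨by simp only []; omega, by simpa using hρ⟩)), fun x hx => ?_⟩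
  rw [Finset.mem_insert]
  rcases mem_rowOf.mp hx with ⟨_, h2⟩ | ⟨_, h3⟩ | ⟨h4, h5⟩
  · exact absurd h2 (Finset.notMem_empty _)
  · exact absurd h3 Bool.false_ne_true
  · by_cases hxρ : x.val = k + 1 + rho (v.val + 1 - 2 ^ k)
    · exact Or.inl (Fin.ext hxρ)
    · exact Or.inr (mem_tails.mpr (Or.inr ⟨hc, Or.inl ⟨rfl, h4, hT h5, hxρ⟩⟩))

/-- The `α`-block of `δ_Q` on `Y ⊆ Q − 1`. -/
theorem isBlock_del_alpha {v : Fin h} {Q : ℕ} {Y : Finset ℕ} (hv : v.val + 1 = 2 ^ k + Q) (hQ1 : 1 ≤ Q) (hkh : 2 * k + 1 ≤ h)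
    (hY : Y ⊆ bits (Q - 1)) : IsBlock (roots k) (tails k) v (rowOf k Y true ∅) := by
  have hc : 2 ^ k < v.val + 1 := by omega
  have hQv : v.val + 1 - 2 ^ k = Q := by omega
  rw [← hQv] at hY
  refine ⟨⟨k, by omega⟩, mem_roots.mpr (Or.inl rfl), mem_rowOf.mpr (Or.inr (Or.inl ⟨rfl, rfl⟩)), fun x hx => ?_⟩
  rw [Finset.mem_insert]
  rcases mem_rowOf.mp hx with ⟨h1, h2⟩ | ⟨h3, _⟩ | ⟨_, h5⟩
  · exact Or.inr (mem_tails.mpr (Or.inr ⟨hc, Or.inr ⟨rfl, h1, hY h2⟩⟩))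
  · exact Or.inl (Fin.ext h3)
  · exact absurd h5 (Finset.notMem_empty _)

end Blocks

/-! ## 8. The diagonal: every valid column supports its designated row -/

section Diag

variable {k : ℕ}

/-- The empty row. -/
theorem rowOf_empty : rowOf (h := h) k ∅ false ∅ = ∅ := by
  ext x; simp [mem_rowOf]

/-- `2^(k+1) = 2·2^k`. -/
theorem two_pow_succ_eq (k : ℕ) : 2 ^ (k + 1) = 2 * 2 ^ k := by rw [pow_succ]; ring

/-- **The designated row lies in the support of its column** (explicit blocks: personas on the designated index sets, `α`-blocks for the
second vertex of `ω`-edges and E-columns). -/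
theorem doorSupp_dRow {d : Col} (hd : d.Valid k) (hkh : 2 * k + 1 ≤ h) (hKh : 2 ^ (k + 1) - 1 ≤ h) :
    DoorSupp (roots k) (tails k) (colOf (h := h) k d) (dRow k d) := by
  have hpow := two_pow_succ_eq k
  have h1k : 1 ≤ 2 ^ k := Nat.one_le_two_pow
  have h2k : 2 ^ k ≤ h := by omega
  cases d with
  | empty =>
    have hcol : colOf (h := h) k .empty = ∅ := by ext v; simp [colOf, Col.verts]
    rw [hcol, show dRow (h := h) k .empty = ∅ from rowOf_empty, doorSupp_empty]
  | om =>
    rw [colOf_eq_singleton (c := 2 ^ k) Nat.one_le_two_pow h2k rfl, doorSupp_singleton_iff]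
    exact isBlock_om_alpha (by simp only []; omega) hkh
  | gam P =>
    obtain ⟨h1, h2⟩ := hd
    rw [colOf_eq_singleton (c := P) h1 (by omega) rfl, doorSupp_singleton_iff]
    exact isBlock_gam_persona (c := P) (by simp only []; omega) h2 hkh subset_rfl (rho_mem_bits (by omega))
  | del Q =>
    obtain ⟨h1, h2⟩ := hd
    rw [colOf_eq_singleton (c := 2 ^ k + Q) (by omega) (by omega) rfl, doorSupp_singleton_iff]
    exact isBlock_del_persona (Q := Q) (by simp only []; omega) h1 h2 hkh subset_rfl (rho_mem_bits (by omega))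
  | omGam P =>
    obtain ⟨h1, h2⟩ := hd
    rw [colOf_eq_pair (c := P) (c' := 2 ^ k) h1 (by omega) Nat.one_le_two_pow h2k rfl,
      doorSupp_pair_iff _ _ (fun heq => by have := Fin.ext_iff.mp heq; simp only [] at this; omega)]
    refine ⟨rowOf k (bits P) false ∅, rowOf k ∅ true ∅,
      isBlock_gam_persona (c := P) (by simp only []; omega) h2 hkh subset_rfl (rho_mem_bits (by omega)),
      isBlock_om_alpha (by simp only []; omega) hkh, disjoint_rowOf (by simp) (by simp) (by simp), ?_⟩
    rw [rowOf_union]; simp [dRow, Col.dtrip]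
  | omDel Q =>
    obtain ⟨h1, h2⟩ := hd
    rw [colOf_eq_pair (c := 2 ^ k) (c' := 2 ^ k + Q) Nat.one_le_two_pow h2k (by omega) (by omega) rfl,
      doorSupp_pair_iff _ _ (fun heq => by have := Fin.ext_iff.mp heq; simp only [] at this; omega)]
    refine ⟨rowOf k ∅ true ∅, rowOf k ∅ false (bits Q), isBlock_om_alpha (by simp only []; omega) hkh,
      isBlock_del_persona (Q := Q) (by simp only []; omega) h1 h2 hkh subset_rfl (rho_mem_bits (by omega)),
      disjoint_rowOf (by simp) (by simp) (by simp), ?_⟩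
    rw [rowOf_union]; simp [dRow, Col.dtrip]
  | cross P Q =>
    obtain ⟨h1, h2, h3, h4⟩ := hd
    rw [colOf_eq_pair (c := P) (c' := 2 ^ k + Q) h1 (by omega) (by omega) (by omega) rfl,
      doorSupp_pair_iff _ _ (fun heq => by have := Fin.ext_iff.mp heq; simp only [] at this; omega)]
    refine ⟨rowOf k (bits P) false ∅, rowOf k ∅ false (bits Q),
      isBlock_gam_persona (c := P) (by simp only []; omega) h2 hkh subset_rfl (rho_mem_bits (by omega)),
      isBlock_del_persona (Q := Q) (by simp only []; omega) h3 h4 hkh subset_rfl (rho_mem_bits (by omega)),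
      disjoint_rowOf (by simp) (by simp) (by simp), ?_⟩
    rw [rowOf_union]; simp [dRow, Col.dtrip]
  | gg P P' =>
    obtain ⟨h1, h2, h3⟩ := hd
    rw [colOf_eq_pair (c := P) (c' := P') h1 (by omega) (by omega) (by omega) rfl,
      doorSupp_pair_iff _ _ (fun heq => by have := Fin.ext_iff.mp heq; simp only [] at this; omega)]
    refine ⟨rowOf k (bits P) false ∅, rowOf k ∅ true (bits P'),
      isBlock_gam_persona (c := P) (by simp only []; omega) (by omega) hkh subset_rfl (rho_mem_bits (by omega)),
      isBlock_gam_alpha (c := P') (by simp only []; omega) h3 hkh subset_rfl, disjoint_rowOf (by simp) (by simp) (by simp), ?_⟩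
    rw [rowOf_union]; simp [dRow, Col.dtrip]
  | dd Q Q' =>
    obtain ⟨h1, h2, h3⟩ := hd
    rw [colOf_eq_pair (c := 2 ^ k + Q) (c' := 2 ^ k + Q') (by omega) (by omega) (by omega) (by omega) rfl,
      doorSupp_pair_iff _ _ (fun heq => by have := Fin.ext_iff.mp heq; simp only [] at this; omega)]
    refine ⟨rowOf k ∅ false (bits Q), rowOf k (bits (Q' - 1)) true ∅,
      isBlock_del_persona (Q := Q) (by simp only []; omega) h1 (by omega) hkh subset_rfl (rho_mem_bits (by omega)),
      isBlock_del_alpha (Q := Q') (by simp only []; omega) (by omega) hkh subset_rfl, disjoint_rowOf (by simp) (by simp) (by simp), ?_⟩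
    rw [rowOf_union]; simp [dRow, Col.dtrip]

end Diag

/-! ## 9. Triangularity: a row in the support of a column is the designated row or is owned by a column with smaller key -/

section Support

variable {k : ℕ}

/-- Radix facts for `omega`. -/
theorem radix_facts (k : ℕ) : 1 < radix k ∧ 2 ^ k < radix k ∧ 2 * k + 2 < radix k := by
  have h1 : 1 ≤ 2 ^ k := Nat.one_le_two_pow
  have h2 : k < 2 ^ k := Nat.lt_two_pow_self
  unfold radix; omega

/-- `S ⊆ bits n ⇒ enc S ≤ n`. -/
theorem enc_le_of_subset_bits {S : Finset ℕ} {n : ℕ} (hS : S ⊆ bits n) : enc S ≤ n := by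
  have := enc_le_enc_of_subset hS; rwa [enc_bits] at this

/-- `S ⊊ bits n ⇒ enc S < n`. -/
theorem enc_lt_of_ne_bits {S : Finset ℕ} {n : ℕ} (hS : S ⊆ bits n) (hne : S ≠ bits n) : enc S < n := by
  have := enc_lt_enc_of_ssubset (lt_of_le_of_ne hS hne); rwa [enc_bits] at this

/-- `S ⊊ bits n ⇒ |S| < |bits n|`. -/
theorem card_lt_of_ne_bits {S : Finset ℕ} {n : ℕ} (hS : S ⊆ bits n) (hne : S ≠ bits n) : S.card < (bits n).card :=
  Finset.card_lt_card (lt_of_le_of_ne hS hne)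

/-- `enc S = n ⇒ S = bits n`. -/
theorem eq_bits_of_enc_eq {S : Finset ℕ} {n : ℕ} (hS : enc S = n) : S = bits n := by rw [← bits_enc S, hS]

/-- `S ⊆ range k ⇒ |S| ≤ k`. -/
theorem card_le_of_subset_range {S : Finset ℕ} (hS : S ⊆ range k) : S.card ≤ k := by simpa using Finset.card_le_card hS

/-- A face whose decoding is the designated triple is the designated row. -/
theorem eq_dRow_of {d : Col} {U : Finset (Fin h)} (hS : aIdx k U = d.dtrip.1) (he : eBit k U = d.dtrip.2.1) (hT : bIdx k U = d.dtrip.2.2) :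
    U = dRow k d := by
  rw [← rowOf_decode k U, hS, he, hT]; rfl

/-- Triangularity at the empty column. -/
theorem supp_empty {U : Finset (Fin h)} (hsupp : DoorSupp (roots k) (tails k) (colOf k .empty) U) :
    U = dRow k .empty ∨ (own (aIdx k U) (eBit k U) (bIdx k U)).key k < Col.key k .empty := by
  have hcol : colOf (h := h) k .empty = ∅ := by ext v; simp [colOf, Col.verts]
  rw [hcol, doorSupp_empty] at hsupp
  left; rw [hsupp]; exact (rowOf_empty (h := h) (k := k)).symm

/-- Triangularity at `ω`. -/
theorem supp_om (hKh : 2 ^ (k + 1) - 1 ≤ h) {U : Finset (Fin h)} (hsupp : DoorSupp (roots k) (tails k) (colOf k .om) U) :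
    U = dRow k .om ∨ (own (aIdx k U) (eBit k U) (bIdx k U)).key k < Col.key k .om := by
  have hpow := two_pow_succ_eq k
  have h1k : 1 ≤ 2 ^ k := Nat.one_le_two_pow
  rw [colOf_eq_singleton (c := 2 ^ k) h1k (by omega) rfl, doorSupp_singleton_iff] at hsupp
  obtain ⟨-, hA, hE, hB⟩ := isBlock_om (by simp only []; omega) hsupp
  exact Or.inl (eq_dRow_of hA hE hB)

/-- Triangularity at `γ_P`. -/
theorem supp_gam {P : ℕ} (hd : (Col.gam P).Valid k) (hKh : 2 ^ (k + 1) - 1 ≤ h) {U : Finset (Fin h)}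
    (hsupp : DoorSupp (roots k) (tails k) (colOf k (.gam P)) U) :
    U = dRow k (.gam P) ∨ (own (aIdx k U) (eBit k U) (bIdx k U)).key k < (Col.gam P).key k := by
  obtain ⟨hR1, hR2, hR3⟩ := radix_facts k
  have hpow := two_pow_succ_eq k
  obtain ⟨h1, h2⟩ := hd
  rw [colOf_eq_singleton (c := P) h1 (by omega) rfl, doorSupp_singleton_iff] at hsupp
  obtain ⟨-, hshape⟩ := isBlock_gam (c := P) (by simp only []; omega) h2 hsupp
  have hSk : enc (aIdx k U) < 2 ^ k := enc_lt_two_pow (aIdx_subset_range k U)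
  rcases hshape with ⟨he, hT, hS, hρ⟩ | ⟨he, hS, hT⟩
  · by_cases hSP : aIdx k U = bits P
    · exact Or.inl (eq_dRow_of hSP he hT)
    · right
      have hlt : enc (aIdx k U) < P := enc_lt_of_ne_bits hS hSP
      rw [he, hT, own_gam (Finset.ne_empty_of_mem hρ)]
      refine key_lt_key ?_ ?_ ?_ ?_ ?_ <;> simp only [Col.tup, true_and, and_false, false_or, or_false, lt_self_iff_false] <;> omega
  · right
    have hTk : enc (bIdx k U) < 2 ^ k := enc_lt_two_pow (hT.trans (bits_subset_range h2))
    by_cases hT0 : bIdx k U = ∅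
    · rw [hS, he, hT0, own_om]
      refine key_lt_key ?_ ?_ ?_ ?_ ?_ <;> simp only [Col.tup, true_and, and_false, false_or, or_false, lt_self_iff_false] <;> omega
    · rw [hS, he, own_omDel hT0]
      refine key_lt_key ?_ ?_ ?_ ?_ ?_ <;> simp only [Col.tup, and_false, or_false, lt_self_iff_false] <;> omega

/-- Triangularity at `δ_Q`. -/
theorem supp_del {Q : ℕ} (hd : (Col.del Q).Valid k) (hKh : 2 ^ (k + 1) - 1 ≤ h) {U : Finset (Fin h)}
    (hsupp : DoorSupp (roots k) (tails k) (colOf k (.del Q)) U) :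
    U = dRow k (.del Q) ∨ (own (aIdx k U) (eBit k U) (bIdx k U)).key k < (Col.del Q).key k := by
  obtain ⟨hR1, hR2, hR3⟩ := radix_facts k
  have hpow := two_pow_succ_eq k
  obtain ⟨h1, h2⟩ := hd
  rw [colOf_eq_singleton (c := 2 ^ k + Q) (by omega) (by omega) rfl, doorSupp_singleton_iff] at hsupp
  obtain ⟨-, hshape⟩ := isBlock_del (Q := Q) (by simp only []; omega) h1 h2 hsupp
  have hSk : enc (aIdx k U) < 2 ^ k := enc_lt_two_pow (aIdx_subset_range k U)
  rcases hshape with ⟨he, hS, hT, hρ⟩ | ⟨he, hT, hS⟩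
  · by_cases hTQ : bIdx k U = bits Q
    · exact Or.inl (eq_dRow_of hS he hTQ)
    · right
      have hlt : enc (bIdx k U) < Q := enc_lt_of_ne_bits hT hTQ
      rw [he, hS, own_del (Finset.ne_empty_of_mem hρ)]
      refine key_lt_key ?_ ?_ ?_ ?_ ?_ <;> simp only [Col.tup, true_and, and_false, false_or, or_false, lt_self_iff_false] <;> omega
  · right
    by_cases hS0 : aIdx k U = ∅
    · rw [hS0, he, hT, own_om]
      refine key_lt_key ?_ ?_ ?_ ?_ ?_ <;> simp only [Col.tup, and_false, or_false, lt_self_iff_false] <;> omega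
    · rw [he, hT, own_omGam hS0]
      refine key_lt_key ?_ ?_ ?_ ?_ ?_ <;> simp only [Col.tup, and_false, or_false, lt_self_iff_false] <;> omega

/-- Triangularity at `ωγ_P`. -/
theorem supp_omGam {P : ℕ} (hd : (Col.omGam P).Valid k) (hkh : 2 * k + 1 ≤ h) (hKh : 2 ^ (k + 1) - 1 ≤ h) {U : Finset (Fin h)}
    (hsupp : DoorSupp (roots k) (tails k) (colOf k (.omGam P)) U) :
    U = dRow k (.omGam P) ∨ (own (aIdx k U) (eBit k U) (bIdx k U)).key k < (Col.omGam P).key k := by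
  obtain ⟨hR1, hR2, hR3⟩ := radix_facts k
  have hpow := two_pow_succ_eq k
  have h1k : 1 ≤ 2 ^ k := Nat.one_le_two_pow
  obtain ⟨h1, h2⟩ := hd
  rw [colOf_eq_pair (c := P) (c' := 2 ^ k) h1 (by omega) h1k (by omega) rfl,
    doorSupp_pair_iff _ _ (fun heq => by have := Fin.ext_iff.mp heq; simp only [] at this; omega)] at hsupp
  obtain ⟨X, Y, hX, hY, hXY, rfl⟩ := hsupp
  obtain ⟨-, hshape⟩ := isBlock_gam (c := P) (by simp only []; omega) h2 hX
  obtain ⟨-, hYa, hYe, hYb⟩ := isBlock_om (by simp only []; omega) hY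
  have hA : aIdx k (X ∪ Y) = aIdx k X := by rw [aIdx_union, hYa, Finset.union_empty]
  have hE : eBit k (X ∪ Y) = true := by rw [eBit_union, hYe, Bool.or_true]
  have hB : bIdx k (X ∪ Y) = bIdx k X := by rw [bIdx_union, hYb, Finset.union_empty]
  rw [hA, hE, hB]
  rcases hshape with ⟨he, hT, hS, hρ⟩ | ⟨he, hS, hT⟩
  · by_cases hSP : aIdx k X = bits P
    · exact Or.inl (eq_dRow_of (hA.trans hSP) hE (hB.trans hT))
    · right
      have hlt : enc (aIdx k X) < P := enc_lt_of_ne_bits hS hSP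
      rw [hT, own_omGam (Finset.ne_empty_of_mem hρ)]
      refine key_lt_key ?_ ?_ ?_ ?_ ?_ <;> simp only [Col.tup, true_and, and_false, false_or, or_false, lt_self_iff_false] <;> omega
  · exact absurd ⟨he, hYe⟩ (not_eBit_and hXY)

/-- Triangularity at `ωδ_Q`. -/
theorem supp_omDel {Q : ℕ} (hd : (Col.omDel Q).Valid k) (hkh : 2 * k + 1 ≤ h) (hKh : 2 ^ (k + 1) - 1 ≤ h) {U : Finset (Fin h)}
    (hsupp : DoorSupp (roots k) (tails k) (colOf k (.omDel Q)) U) :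
    U = dRow k (.omDel Q) ∨ (own (aIdx k U) (eBit k U) (bIdx k U)).key k < (Col.omDel Q).key k := by
  obtain ⟨hR1, hR2, hR3⟩ := radix_facts k
  have hpow := two_pow_succ_eq k
  have h1k : 1 ≤ 2 ^ k := Nat.one_le_two_pow
  obtain ⟨h1, h2⟩ := hd
  rw [colOf_eq_pair (c := 2 ^ k) (c' := 2 ^ k + Q) h1k (by omega) (by omega) (by omega) rfl,
    doorSupp_pair_iff _ _ (fun heq => by have := Fin.ext_iff.mp heq; simp only [] at this; omega)] at hsupp
  obtain ⟨X, Y, hX, hY, hXY, rfl⟩ := hsupp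
  obtain ⟨-, hXa, hXe, hXb⟩ := isBlock_om (by simp only []; omega) hX
  obtain ⟨-, hshape⟩ := isBlock_del (Q := Q) (by simp only []; omega) h1 h2 hY
  have hA : aIdx k (X ∪ Y) = aIdx k Y := by rw [aIdx_union, hXa, Finset.empty_union]
  have hE : eBit k (X ∪ Y) = true := by rw [eBit_union, hXe, Bool.true_or]
  have hB : bIdx k (X ∪ Y) = bIdx k Y := by rw [bIdx_union, hXb, Finset.empty_union]
  rw [hA, hE, hB]
  rcases hshape with ⟨he, hS, hT, hρ⟩ | ⟨he, hT, hS⟩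
  · by_cases hTQ : bIdx k Y = bits Q
    · exact Or.inl (eq_dRow_of (hA.trans hS) hE (hB.trans hTQ))
    · right
      have hlt : enc (bIdx k Y) < Q := enc_lt_of_ne_bits hT hTQ
      rw [hS, own_omDel (Finset.ne_empty_of_mem hρ)]
      refine key_lt_key ?_ ?_ ?_ ?_ ?_ <;> simp only [Col.tup, true_and, and_false, false_or, or_false, lt_self_iff_false] <;> omega
  · exact absurd ⟨hXe, he⟩ (not_eBit_and hXY)


end Support

end DecFamily

end Summit.ValiantsHypothesis.ValiantsHypothesis.Theorems.BarrierLever.AnchoredPeeling
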